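import Summits.FinalStateConjecture.FinalStateConjecture.Theorems.ZeroEnergyKerrOrBombStationaryLimitReductionKerrSchildSlabs
import Summits.FinalStateConjecture.FinalStateConjecture.Theorems.ZeroEnergyKerrOrBombSymplecticDualOfTheBombDefs2
import HarnessLib

/-!
# Route ZeroEnergyKerrOrBomb · crux `StationaryLimitReduction` (stmt-FinalStateConjecture-10021), line
# `symplectic-dual-of-the-bomb` (reshape r3) — the RECUT DECOMPOSITION of the chart transfer `stub_chartTransfer`

Helper file (`--supports stmt-FinalStateConjecture-10021`; registered helper `kerrChartedWith_tilt_bound`)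
of the lead's wave-2 stub-worker for `stub_chartTransfer` (lead prover-line-stmt-FinalStateConjecture-10021-a1-0,
2026-08-16). Over the r3 vocabulary of `…SymplecticDualOfTheBombDefs2.lean` (`IsKerrChartedWith`, `recutMap`,
`recutImage`, `recutBackground`, `recutCharted`, `recutInitialSlabs`, `recutCertifiedLate`,
`recutCertifiedSlab`) it lands the bookkeeping of the naive Kerr–Schild recut of a stationary final-state
decomposition `d` along Kerr identifications `Θᵢ`:

* §1 generic: restricting an open embedding to an open subset (`isOpenEmbedding_restrict_mono`), re-basing
  a late chart at a later time (`isLateChart_rebase`), openness of late images and late regions, and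
  "growing radii serve every fixed radius" (`tendsto_truncDeviationCk_of_tendsto_atTop`);
* §2 `kerrChartedWith_tilt_bound`: the tilt `(Θ u)⁰ − c u⁰` of an asymptotically controlled `T`-equivariant
  Kerr identification is bounded on the WHOLE Kerr exterior (far out by the control clause, on the strip
  `r₊ < r < r₊ + 1` by equivariance + compactness of the slab piece `{t* = 0, r₊ ≤ r ≤ r₊ + 1}` inside the
  collar region `{r > max r₀ 0}`, `r₀ < r₊`);
* §3 the recut charts `recutChart d M a Θ hmaps i = ψᵢ ∘ recutMap Θᵢ`, the identities
  `recutImage d Θ i (val '' S) = recutChart … i '' S` and the resulting descriptions of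
  `recutCharted/recutInitialSlabs/recutCertifiedLate/recutCertifiedSlab`, and the RECUT DECOMPOSITION
  `recutDecomposition` (a `FinalStateDecomposition` with the clauses supplied as hypotheses) together with
  `charted_recutDecomposition = recutCharted`, `certifiedLate_recutDecomposition = recutCertifiedLate`,
  `certifiedSlab_recutDecomposition = recutCertifiedSlab` (the summit's sets).

Elementary; no named fact, nothing restated. References: Dafermos–Luk arXiv:1710.01722, §1.2.1 and
Conjecture 1 (b)–(c); DHRT arXiv:2104.08222, §1.
-/

-- every `Summit.FinalStateConjecture.FinalStateConjecture.…` name repeats the summit = sub-problem segment (D-0017 layout)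
set_option linter.dupNamespace false

noncomputable section

open scoped Topology ENNReal Manifold ContDiff
open Set Filter Function

namespace Summit.FinalStateConjecture.FinalStateConjecture.Theorems.SymplecticDualOfTheBomb

open Literature.Geometry.Lorentzian

/-! ## §1 Generic lemmas: restriction of open embeddings, re-basing late charts, growing radii -/

/-- Restricting an open embedding `f|t` to an open `s ⊆ t` keeps an open embedding (`f|s = f|t ∘ ι`,
`ι : s ↪ t` the open inclusion). [folklore] -/
theorem isOpenEmbedding_restrict_mono {α β : Type*} [TopologicalSpace α] [TopologicalSpace β]
    {f : α → β} {s t : Set α} (h : Topology.IsOpenEmbedding (t.restrict f)) (hst : s ⊆ t)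
    (hs : IsOpen s) : Topology.IsOpenEmbedding (s.restrict f) :=
  have heq : s.restrict f = t.restrict f ∘ Set.inclusion hst := rfl
  heq ▸ h.comp (Topology.IsOpenEmbedding.inclusion hst (hs.preimage continuous_subtype_val))

section LateChart

variable {𝓢 : Spacetime.{0} 4}

/-- **Re-basing a late chart.** A late chart into `O` after `τ₀` is a late chart into `O'` after any
`τ₁ ≥ τ₀` with open late region, given the image clause for `O'`. [folklore] -/
theorem isLateChart_rebase (B : ModelBackground) {O O' : Set 𝓢.carrier} {τ₀ τ₁ : ℝ}
    {ψ : B.domain → 𝓢.carrier} (h : 𝓢.IsLateChart B O τ₀ ψ) (hτ : τ₀ ≤ τ₁)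
    (hopen : IsOpen (B.lateRegion τ₁)) (himg : ψ '' B.lateRegion τ₁ ⊆ O') :
    𝓢.IsLateChart B O' τ₁ ψ :=
  ⟨h.contMDiff, isOpenEmbedding_restrict_mono h.isOpenEmbedding (B.lateRegion_mono hτ) hopen, himg⟩

/-- The image of the late region under a late chart is open. [folklore] -/
theorem isOpen_image_of_isLateChart {B : ModelBackground} {O : Set 𝓢.carrier} {τ₀ : ℝ}
    {ψ : B.domain → 𝓢.carrier} (h : 𝓢.IsLateChart B O τ₀ ψ) : IsOpen (ψ '' B.lateRegion τ₀) := by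
  rw [← range_restrict]
  exact h.isOpenEmbedding.isOpen_range

/-- **Growing radii serve every fixed radius**: if `R'(τ) → ∞` and the truncated deviation out to
`R'(τ)` tends to `0`, so does the truncated deviation out to every fixed `R` (monotonicity in the
radius, `truncDeviationCk_mono`). [folklore] -/
theorem tendsto_truncDeviationCk_of_tendsto_atTop (B : ModelBackground) (ψ : B.domain → 𝓢.carrier)
    (k : ℕ) {R' : ℝ → ℝ} (hR' : Tendsto R' atTop atTop)
    (h : Tendsto (fun τ ↦ 𝓢.truncDeviationCk B ψ k (R' τ) τ) atTop (𝓝 0)) (R : ℝ) :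
    Tendsto (fun τ ↦ 𝓢.truncDeviationCk B ψ k R τ) atTop (𝓝 0) := by
  refine tendsto_of_tendsto_of_tendsto_of_le_of_le' tendsto_const_nhds h
    (Eventually.of_forall fun _ ↦ zero_le) ?_
  filter_upwards [hR'.eventually_ge_atTop R] with τ hτ
  exact 𝓢.truncDeviationCk_mono B ψ k hτ τ

/-- The late regions of the flat background are open (its time `x⁰` is continuous). [folklore] -/
theorem isOpen_lateRegion_backgroundOn (U : TopologicalSpace.Opens E4) (τ : ℝ) :
    IsOpen ((Minkowski.backgroundOn U).lateRegion τ) :=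
  isOpen_lt continuous_const
    ((EuclideanSpace.proj (𝕜 := ℝ) (0 : Fin 4)).continuous.comp continuous_subtype_val)

end LateChart

/-! ## §2 The tilt of an asymptotically controlled Kerr identification is bounded on the whole exterior -/

/-- **Registered helper `kerrChartedWith_tilt_bound`.** For `IsKerrChartedWith 𝓑 A M a c r₀ Θ` the tilt
`(Θ u)⁰ − c u⁰` is bounded on the WHOLE Kerr exterior: on `{r ≥ r₊ + 1}` by the asymptotic-control
clause, and on the strip `{r₊ < r < r₊ + 1}` because, by `T`-equivariance, the tilt only depends on the
foot point `(0, y)`, which ranges in the compact slab piece `{t* = 0, r₊ ≤ r ≤ r₊ + 1} ⊆ {r > max r₀ 0}`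
(`r₀ < r₊`, the collar) where `Θ` is continuous. [folklore] -/
theorem kerrChartedWith_tilt_bound : ∀ (𝓑 : StationaryAFBlackHole.{0}) (A : 𝓑.AdaptedChart) (M a c r₀ : ℝ) (Θ : E4 → E4), IsKerrChartedWith 𝓑 A M a c r₀ Θ → ∃ L : ℝ, ∀ u ∈ (Kerr.exterior M a : Set E4), |Θ u 0 - c * u 0| ≤ L := by
  intro 𝓑 A M a c r₀ Θ h
  obtain ⟨hsub, -, -, hr₀, hΘs, -, -, hΘe, -, -, L, hL⟩ := h
  have hrp : 0 < Kerr.rPlus M a := hsub.pos.trans_le (le_add_of_nonneg_right (Real.sqrt_nonneg _))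
  set K : Set E4 := {x | E4.time x = 0 ∧ Kerr.rPlus M a ≤ Kerr.radius a x ∧
    Kerr.radius a x ≤ Kerr.rPlus M a + 1} with hK
  have hKc : IsCompact K := isCompact_kerrSlabPiece a hrp _
  have hKr : K ⊆ (Kerr.region a r₀ : Set E4) := kerrSlabPiece_subset_region a (max_lt hr₀ hrp) _
  obtain ⟨L₀, hL₀⟩ := hKc.exists_bound_of_continuousOn (f := fun x ↦ Θ x 0)
    (((EuclideanSpace.proj (𝕜 := ℝ) (0 : Fin 4)).continuous.comp_continuousOn hΘs.continuousOn).mono hKr)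
  refine ⟨max L L₀, fun u hu ↦ ?_⟩
  by_cases hfar : Kerr.rPlus M a + 1 ≤ Kerr.radius a u
  · exact ((hL u hu hfar).1).trans (le_max_left _ _)
  · -- the strip: reduce to the foot point
    have hext : Kerr.rPlus M a < Kerr.radius a u := (le_max_left _ _).trans_lt (Kerr.mem_exterior.1 hu)
    have hfoot : E4.ofTimeSpace 0 (E4.spatial u) ∈ K := by
      refine ⟨E4.time_ofTimeSpace 0 _, ?_, ?_⟩
      · rw [Kerr.radius_ofTimeSpace_spatial]; exact hext.le
      · rw [Kerr.radius_ofTimeSpace_spatial]; exact (not_le.1 hfar).le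
    have hreg : u ∈ (Kerr.region a r₀ : Set E4) :=
      Kerr.mem_region.2 ((max_lt hr₀ hrp).trans hext)
    have htime := time_apply_eq (kerrRegion_add_smul_mem a r₀) hΘe hreg
    rw [E4.time_apply, E4.time_apply, E4.time_apply] at htime
    have h0 := hL₀ _ hfoot
    rw [Real.norm_eq_abs] at h0
    rw [htime, add_sub_cancel_right]
    exact h0.trans (le_max_right _ _)

/-! ## §3 The recut charts: images, charted sets, and the recut decomposition -/

section Recut

variable {𝓢 : Spacetime.{0} 4} {O : Set 𝓢.carrier} {k : ℕ}

/-- **The recut chart of hole `i`**: the old late chart `ψᵢ` re-adapted to boosted Kerr–Schild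
coordinates, `ψᵢ ∘ recutMap Θᵢ` on the boosted Kerr exterior. [cite: DafermosLuk2017, §1.2.1] -/
def recutChart (d : StationaryFinalStateDecomposition 𝓢 O k) (M a : Fin d.N → ℝ)
    (Θ : Fin d.N → E4 → E4)
    (hmaps : ∀ i, MapsTo (recutMap (d.motion i).1 (d.motion i).2 (Θ i))
      ((recutBackground d M a i).domain : Set E4) ((d.background i).domain : Set E4))
    (i : Fin d.N) (y : (recutBackground d M a i).domain) : 𝓢.carrier :=
  d.toOver.chart i ⟨recutMap (d.motion i).1 (d.motion i).2 (Θ i) y.1, hmaps i y.2⟩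

variable (d : StationaryFinalStateDecomposition 𝓢 O k) (M a : Fin d.N → ℝ) (Θ : Fin d.N → E4 → E4)
  (hmaps : ∀ i, MapsTo (recutMap (d.motion i).1 (d.motion i).2 (Θ i))
    ((recutBackground d M a i).domain : Set E4) ((d.background i).domain : Set E4))

/-- `recutImage` of a set of boosted Kerr–Schild points is its image under the recut chart. [folklore] -/
theorem recutImage_image_val (i : Fin d.N) (S : Set (recutBackground d M a i).domain) :
    recutImage d Θ i (Subtype.val '' S) = recutChart d M a Θ hmaps i '' S := by
  ext p
  constructor
  · rintro ⟨x, ⟨z, ⟨y, hy, rfl⟩, hz⟩, rfl⟩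
    refine ⟨y, hy, ?_⟩
    show d.toOver.chart i _ = d.toOver.chart i x
    congr 1
    exact Subtype.ext hz
  · rintro ⟨y, hy, rfl⟩
    exact ⟨⟨_, hmaps i y.2⟩, ⟨y.1, ⟨y, hy, rfl⟩, rfl⟩, rfl⟩

/-- `recutImage` is monotone in the set. [folklore] -/
theorem recutImage_mono (i : Fin d.N) {S S' : Set E4} (h : S ⊆ S') :
    recutImage d Θ i S ⊆ recutImage d Θ i S' :=
  image_mono fun _ hy ↦ image_mono h hy

/-- The recut charted late region through the recut charts. [folklore] -/
theorem recutCharted_eq (τ : ℝ) : recutCharted d M a Θ τ =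
    d.toOver.flatChart '' (Minkowski.backgroundOn d.toOver.flatDomain).lateRegion τ ∪
      ⋃ i, recutChart d M a Θ hmaps i '' (recutBackground d M a i).lateRegion τ := by
  simp only [recutCharted, recutImage_image_val d M a Θ hmaps]

/-- The recut initial slabs through the recut charts. [folklore] -/
theorem recutInitialSlabs_eq (τ : ℝ) : recutInitialSlabs d M a Θ τ =
    d.toOver.flatChart '' (Minkowski.backgroundOn d.toOver.flatDomain).timeSlab τ ∪
      ⋃ i, recutChart d M a Θ hmaps i '' (recutBackground d M a i).timeSlab τ := by
  simp only [recutInitialSlabs, recutImage_image_val d M a Θ hmaps]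

/-- The recut certified late region through the recut charts. [folklore] -/
theorem recutCertifiedLate_eq (R' : Fin d.N → ℝ → ℝ) (τ₁ : ℝ) : recutCertifiedLate d M a Θ R' τ₁ =
    d.toOver.flatChart '' (Minkowski.backgroundOn d.toOver.flatDomain).lateRegion τ₁ ∪
      ⋃ i, recutChart d M a Θ hmaps i '' {x | τ₁ < (recutBackground d M a i).time x.1 ∧
        (recutBackground d M a i).radius x.1 ≤ R' i ((recutBackground d M a i).time x.1)} := by
  simp only [recutCertifiedLate, recutImage_image_val d M a Θ hmaps]

/-- The recut certified slab through the recut charts. [folklore] -/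
theorem recutCertifiedSlab_eq (R' : Fin d.N → ℝ → ℝ) (τ₁ : ℝ) : recutCertifiedSlab d M a Θ R' τ₁ =
    d.toOver.flatChart '' (Minkowski.backgroundOn d.toOver.flatDomain).timeSlab τ₁ ∪
      ⋃ i, recutChart d M a Θ hmaps i '' (recutBackground d M a i).truncTimeSlab (R' i τ₁) τ₁ := by
  simp only [recutCertifiedSlab, recutImage_image_val d M a Θ hmaps]

/-- The recut charted late regions shrink as the late time grows. [folklore] -/
theorem recutCharted_anti {τ₁ τ₂ : ℝ} (h : τ₁ ≤ τ₂) : recutCharted d M a Θ τ₂ ⊆ recutCharted d M a Θ τ₁ :=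
  union_subset_union (image_mono ((Minkowski.backgroundOn d.toOver.flatDomain).lateRegion_mono h))
    (iUnion_mono fun i ↦ recutImage_mono d Θ i (image_mono ((recutBackground d M a i).lateRegion_mono h)))

/-- The recut certified late region after `τ₁` lies in the recut charted late region of `τ₁`. [folklore] -/
theorem recutCertifiedLate_subset (R' : Fin d.N → ℝ → ℝ) (τ₁ : ℝ) :
    recutCertifiedLate d M a Θ R' τ₁ ⊆
      (⋃ i, recutChart d M a Θ hmaps i '' (recutBackground d M a i).lateRegion τ₁) ∪
        d.toOver.flatChart '' (Minkowski.backgroundOn d.toOver.flatDomain).lateRegion τ₁ := by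
  rw [recutCertifiedLate_eq d M a Θ hmaps, union_comm]
  exact union_subset_union (iUnion_mono fun i ↦ image_mono fun x hx ↦ hx.1) le_rfl

/-- The recut certified slab at `τ₁` lies in the recut slabs at `τ₁`. [folklore] -/
theorem recutCertifiedSlab_subset (R' : Fin d.N → ℝ → ℝ) (τ₁ : ℝ) :
    recutCertifiedSlab d M a Θ R' τ₁ ⊆
      (⋃ i, recutChart d M a Θ hmaps i '' (recutBackground d M a i).timeSlab τ₁) ∪
        d.toOver.flatChart '' (Minkowski.backgroundOn d.toOver.flatDomain).timeSlab τ₁ := by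
  rw [recutCertifiedSlab_eq d M a Θ hmaps, union_comm]
  exact union_subset_union
    (iUnion_mono fun i ↦ image_mono ((recutBackground d M a i).truncTimeSlab_subset_timeSlab _ _)) le_rfl

variable {O' : Set 𝓢.carrier} (τ₀'' : ℝ) (mass_pos : ∀ i, 0 < M i) (abs_spin_le : ∀ i, |a i| ≤ M i)
  (hlate : ∀ i, 𝓢.IsLateChart (recutBackground d M a i) O' τ₀'' (recutChart d M a Θ hmaps i))
  (hconv : ∀ i (R : ℝ), Tendsto (fun τ ↦ 𝓢.truncDeviationCk (recutBackground d M a i)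
    (recutChart d M a Θ hmaps i) k R τ) atTop (𝓝 0))
  (hsep : ∀ R : ℝ, ∃ τ₁ : ℝ, Pairwise (Function.onFun Disjoint fun i ↦
    recutChart d M a Θ hmaps i '' (recutBackground d M a i).truncLateRegion τ₁ R))
  (ρ : Fin d.N → ℝ → ℝ) (hρ : ∀ i, Tendsto (fun t ↦ ρ i t / t) atTop (𝓝 0))
  (hρdom : {x : E4 | τ₀'' < x 0 ∧ ∀ i, ρ i (x 0) < (recutBackground d M a i).radius x} ⊆
    (d.toOver.flatDomain : Set E4))
  (hflat : 𝓢.IsLateChart (Minkowski.backgroundOn d.toOver.flatDomain) O' τ₀'' d.toOver.flatChart)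
  (hcov : O' \ ((⋃ i, recutChart d M a Θ hmaps i '' (recutBackground d M a i).lateRegion τ₀'') ∪
      d.toOver.flatChart '' (Minkowski.backgroundOn d.toOver.flatDomain).lateRegion τ₀'') ⊆
    𝓢.metric.causalPast 𝓢.timeOrientation
      ((⋃ i, recutChart d M a Θ hmaps i '' (recutBackground d M a i).timeSlab τ₀'') ∪
        d.toOver.flatChart '' (Minkowski.backgroundOn d.toOver.flatDomain).timeSlab τ₀''))

/-- **The recut decomposition** (naive Kerr–Schild recut of a stationary decomposition `d`): `N`, the
motions, the flat chart/domain and its convergence kept; masses `Mᵢ`, spins `aᵢ`; hole charts the recut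
charts `ψᵢ ∘ recutMap Θᵢ`; late time `τ₀''`; the remaining clauses supplied as hypotheses.
[cite: DafermosLuk2017, §1.2.1] -/
def recutDecomposition : FinalStateDecomposition 𝓢 O' k :=
  FinalStateDecomposition.ofOver M a mass_pos abs_spin_le d.motion
    { τ₀ := τ₀''
      chart := recutChart d M a Θ hmaps
      isLateChart := hlate
      tendsto_truncDeviationCk := hconv
      exists_pairwise_disjoint := hsep
      excision := ρ
      tendsto_excision_div := hρ
      flatDomain := d.toOver.flatDomain
      setOf_lt_excision_subset_flatDomain := hρdom
      flatChart := d.toOver.flatChart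
      isLateChart_flat := hflat
      tendsto_deviationCk_flat := d.toOver.tendsto_deviationCk_flat
      diff_subset_causalPast := hcov }

/-- The charted late region of the recut decomposition is `recutCharted d M a Θ τ₀''`. [folklore] -/
theorem charted_recutDecomposition :
    (recutDecomposition d M a Θ hmaps τ₀'' mass_pos abs_spin_le hlate hconv hsep ρ hρ hρdom hflat hcov).charted =
      recutCharted d M a Θ τ₀'' := by
  rw [recutCharted_eq d M a Θ hmaps]
  rfl

/-- The summit's certified late regions of the recut decomposition are the `recutCertifiedLate`. [folklore] -/
theorem certifiedLate_recutDecomposition (R' : Fin d.N → ℝ → ℝ) (τ₁ : ℝ) :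
    Summit.FinalStateConjecture.certifiedLate
        (recutDecomposition d M a Θ hmaps τ₀'' mass_pos abs_spin_le hlate hconv hsep ρ hρ hρdom hflat hcov) R' τ₁ =
      recutCertifiedLate d M a Θ R' τ₁ := by
  rw [recutCertifiedLate_eq d M a Θ hmaps]
  rfl

/-- The summit's certified slabs of the recut decomposition are the `recutCertifiedSlab`. [folklore] -/
theorem certifiedSlab_recutDecomposition (R' : Fin d.N → ℝ → ℝ) (τ₁ : ℝ) :
    Summit.FinalStateConjecture.certifiedSlab
        (recutDecomposition d M a Θ hmaps τ₀'' mass_pos abs_spin_le hlate hconv hsep ρ hρ hρdom hflat hcov) R' τ₁ =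
      recutCertifiedSlab d M a Θ R' τ₁ := by
  rw [recutCertifiedSlab_eq d M a Θ hmaps]
  rfl

end Recut

end Summit.FinalStateConjecture.FinalStateConjecture.Theorems.SymplecticDualOfTheBomb

end
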